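import Summits.Parity.GeneralizedHardyLittlewood.Theorems.GreenTaoLevelTwoMNTwoDichotomy

/-!
# Route `GreenTaoLevelTwo`, crux `MNTwo` (stmt-Parity-21276), line `birth`, stub `stub_mnVertical`:
# the type II alternative in `ℤ`-indexed `X`-form (GT 2008b §10, start of the proof of Lemma 24)

First step of the remaining Lemma-24 assembly for `stub_mnVertical` (B. Green, T. Tao, *Quadratic
uniformity of the Möbius function*, Ann. Inst. Fourier 58 (2008) = arXiv:math/0606087, §10:
"which upon relabeling the bounded functions `b` becomes simply `|X| ≳ 1` where
`X := 𝔼_{D<d≤2D} 𝔼_{W<w≤2W} ψ(dw)e(φ(dw)) b(d) b(w)`").  Def-free: the type II alternative exactly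
as it appears in the hypothesis `hL` of `…MNTwoTypeIIHalf.typeII_half` (the output of
`…MNTwoDichotomy.dichotomy` for `F = ψ·e(φ)`) is converted, via `…MNTwoDichotomy.typeII_Xform`,
into the `ℤ`-indexed box form consumed by `…MNTwoProgressionAveraging2.exists_large_progression₂`:
`1`-bounded `b₁, b₂ : ℤ → ℂ` with `G(d,w) = b₂(w)b₁(d)ψ(dw)e(φ(dw))` vanishing outside the box
`[K+1, 2K] × [1, ⌊2N/K⌋]` and `(η⌊2N/K⌋ − 1)·ηK ≤ ‖∑_{box} G‖`.

* `typeII_Xform_int` — the statement just described.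

References: [GreenTao2008QuadraticMobius] arXiv:math/0606087 §10 (proof of Lemma 24, first lines).
-/

noncomputable section

open Finset
open scoped ComplexConjugate

namespace Summit.Parity.GeneralizedHardyLittlewood.GreenTaoLevelTwoMNTwoTypeIIXformInt

open Summit.Parity.GeneralizedHardyLittlewood.GreenTaoLevelTwoMNTwoDichotomy
  (typeII_Xform map_natCast_Icc)

/-- **The type II alternative in `ℤ`-indexed `X`-form.**  For `ψ : ℤ → [0,1]` supported in
`(N, 2N]`, `φ : ℤ → ℝ/ℤ`, `K ≥ 1`, `w' ∈ [1, ⌊2N/K⌋]` and the type II alternative of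
`…MNTwoDichotomy.dichotomy` at level `η > 0` (for `F = ψ·e(φ)`), there are `1`-bounded
`b₁, b₂ : ℤ → ℂ` such that `G(d,w) = b₂(w)b₁(d)ψ(dw)e(φ(dw))` vanishes outside
`[K+1,2K] × [1,⌊2N/K⌋]` and `(η⌊2N/K⌋ − 1)(ηK) ≤ ‖∑_{d∈[K+1,2K]} ∑_{w∈[1,⌊2N/K⌋]} G(d,w)‖`.
[cite: GreenTao2008QuadraticMobius, §10 (proof of Lemma 24, reduction to `|X| ≳ 1`)] -/
theorem typeII_Xform_int {N K w' : ℕ} (hK : 1 ≤ K) (ψ : ℤ → ℝ) (φ : ℤ → UnitAddCircle)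
    (hψ0 : ∀ n, 0 ≤ ψ n) (hψ1 : ∀ n, ψ n ≤ 1) (hsuppN : ∀ n, ψ n ≠ 0 → (N : ℤ) < n ∧ n ≤ 2 * N)
    {η : ℝ} (hη : 0 < η) (hw' : w' ∈ Icc 1 (2 * N / K))
    (hgood : η * ((2 * N / K : ℕ) : ℝ) - 1 ≤ #((Icc 1 (2 * N / K)).filter fun w => w ≠ w' ∧
      η * K ≤ ‖∑ d ∈ Ioc K (min (2 * K) (min (2 * N / w) (2 * N / w'))),
        ((ψ ((d * w : ℕ) : ℤ) : ℝ) : ℂ) * (AddCircle.toCircle (φ ((d * w : ℕ) : ℤ)) : ℂ) *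
          conj (((ψ ((d * w' : ℕ) : ℤ) : ℝ) : ℂ) *
            (AddCircle.toCircle (φ ((d * w' : ℕ) : ℤ)) : ℂ))‖)) :
    ∃ b₁ b₂ : ℤ → ℂ, (∀ d, ‖b₁ d‖ ≤ 1) ∧ (∀ w, ‖b₂ w‖ ≤ 1) ∧
      (∀ d w : ℤ, (d ∉ Icc (((K + 1 : ℕ)) : ℤ) ((2 * K : ℕ) : ℤ) ∨
          w ∉ Icc (((1 : ℕ)) : ℤ) ((2 * N / K : ℕ) : ℤ)) →
        b₂ w * b₁ d * (((ψ (d * w) : ℝ) : ℂ) * (AddCircle.toCircle (φ (d * w)) : ℂ)) = 0) ∧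
      (η * ((2 * N / K : ℕ) : ℝ) - 1) * (η * K) ≤
        ‖∑ d ∈ Icc (((K + 1 : ℕ)) : ℤ) ((2 * K : ℕ) : ℤ),
            ∑ w ∈ Icc (((1 : ℕ)) : ℤ) ((2 * N / K : ℕ) : ℤ),
              b₂ w * b₁ d * (((ψ (d * w) : ℝ) : ℂ) * (AddCircle.toCircle (φ (d * w)) : ℂ))‖ := by
  classical
  -- the summand on `ℕ`
  set F : ℕ → ℂ := fun n => ((ψ n : ℝ) : ℂ) * (AddCircle.toCircle (φ n) : ℂ) with hF
  have hF1 : ∀ n, ‖F n‖ ≤ 1 := by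
    intro n
    simp only [hF, norm_mul, Circle.norm_coe, mul_one, Complex.norm_real, Real.norm_eq_abs,
      abs_of_nonneg (hψ0 n)]
    exact hψ1 n
  have hF2 : ∀ n, 2 * N < n → F n = 0 := by
    intro n hn
    have : ψ n = 0 := by
      by_contra h
      have := (hsuppN n h).2
      omega
    simp only [hF, this, Complex.ofReal_zero, zero_mul]
  have hw'1 : 1 ≤ w' := (mem_Icc.mp hw').1
  have hY : 0 < η * K := by
    have : (0 : ℝ) < K := by exact_mod_cast hK
    positivity
  obtain ⟨b₁, b₂, hb₁, hb₂, hX⟩ := typeII_Xform (N := N) (K := K) (W := 2 * N / K) hw'1 F hF1 hF2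
    hY hgood
  -- extend by zero to `ℤ`
  refine ⟨fun d => if d ∈ Icc (((K + 1 : ℕ)) : ℤ) ((2 * K : ℕ) : ℤ) then b₁ d.toNat else 0,
    fun w => if w ∈ Icc (((1 : ℕ)) : ℤ) ((2 * N / K : ℕ) : ℤ) then b₂ w.toNat else 0,
    fun d => ?_, fun w => ?_, ?_, ?_⟩
  · dsimp only
    by_cases h : d ∈ Icc (((K + 1 : ℕ)) : ℤ) ((2 * K : ℕ) : ℤ)
    · rw [if_pos h]; exact hb₁ _
    · rw [if_neg h, norm_zero]; exact zero_le_one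
  · dsimp only
    by_cases h : w ∈ Icc (((1 : ℕ)) : ℤ) ((2 * N / K : ℕ) : ℤ)
    · rw [if_pos h]; exact hb₂ _
    · rw [if_neg h, norm_zero]; exact zero_le_one
  · intro d w hdw
    rcases hdw with h | h
    · simp only [if_neg h, mul_zero, zero_mul]
    · simp only [if_neg h, zero_mul]
  · -- the `ℤ`-indexed double sum equals the `ℕ`-indexed one of `typeII_Xform`
    have hIoc : Ioc K (2 * K) = Icc (K + 1) (2 * K) := by
      ext d; simp only [mem_Ioc, mem_Icc]; omega
    set g : ℤ → ℤ → ℂ := fun d w =>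
      (if w ∈ Icc (((1 : ℕ)) : ℤ) ((2 * N / K : ℕ) : ℤ) then b₂ w.toNat else 0) *
        (if d ∈ Icc (((K + 1 : ℕ)) : ℤ) ((2 * K : ℕ) : ℤ) then b₁ d.toNat else 0) *
        (((ψ (d * w) : ℝ) : ℂ) * (AddCircle.toCircle (φ (d * w)) : ℂ)) with hg
    have hgdw : ∀ d w : ℕ, d ∈ Icc (K + 1) (2 * K) → w ∈ Icc 1 (2 * N / K) →
        g (d : ℤ) (w : ℤ) = b₂ w * b₁ d * F (d * w) := by
      intro d w hd hw
      have hw' : ((w : ℕ) : ℤ) ∈ Icc (((1 : ℕ)) : ℤ) ((2 * N / K : ℕ) : ℤ) := by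
        rw [← map_natCast_Icc]; exact Finset.mem_map_of_mem _ hw
      have hd' : ((d : ℕ) : ℤ) ∈ Icc (((K + 1 : ℕ)) : ℤ) ((2 * K : ℕ) : ℤ) := by
        rw [← map_natCast_Icc]; exact Finset.mem_map_of_mem _ hd
      simp only [hg]
      rw [if_pos hw', if_pos hd']
      simp only [Int.toNat_natCast, hF]
      push_cast
      ring
    have hsum : ∑ d ∈ Icc (((K + 1 : ℕ)) : ℤ) ((2 * K : ℕ) : ℤ),
        ∑ w ∈ Icc (((1 : ℕ)) : ℤ) ((2 * N / K : ℕ) : ℤ), g d w =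
        ∑ w ∈ Icc 1 (2 * N / K), ∑ d ∈ Ioc K (2 * K), b₂ w * b₁ d * F (d * w) := by
      rw [Finset.sum_comm, hIoc, ← map_natCast_Icc 1 (2 * N / K),
        ← map_natCast_Icc (K + 1) (2 * K), Finset.sum_map]
      refine Finset.sum_congr rfl fun w hw => ?_
      rw [Finset.sum_map]
      refine Finset.sum_congr rfl fun d hd => ?_
      simp only [Nat.castEmbedding_apply]
      exact hgdw d w hd hw
    change (η * ((2 * N / K : ℕ) : ℝ) - 1) * (η * K) ≤
      ‖∑ d ∈ Icc (((K + 1 : ℕ)) : ℤ) ((2 * K : ℕ) : ℤ),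
        ∑ w ∈ Icc (((1 : ℕ)) : ℤ) ((2 * N / K : ℕ) : ℤ), g d w‖
    rw [hsum]
    exact hX

end Summit.Parity.GeneralizedHardyLittlewood.GreenTaoLevelTwoMNTwoTypeIIXformInt
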